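import Mathlib
import Summits.ValiantsHypothesis.ValiantsHypothesis.Theorems.TriangularDimersDivisionEasy.Negative.FalseWithoutDivision

/-!
# `TriangularDimersDivisionEasy` — negative lemma: the crux is FALSE for every `h` with `h(0) ≠ 0`

Crux `stmt-ValiantsHypothesis-5067` (`Theses.DivisionGap.TriangularDimersDivisionEasy`, route
DivisionGap).  Standing disprover (cdisprove gen 1); strengthens `not_monotoneEasyWithoutDivision`
(`h` frozen to `1`) to: NO family of denominators with non-zero CONSTANT TERM works —

  `not_divisionEasy_with_unit_h : ¬ ∃ c, ∀ n, ∃ h, coeff 0 h ≠ 0 ∧ L₊(D_n · h) + L₊(h) ≤ 2^((log₂ n + c)^c)`.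

Reason: the degree-`n²` homogeneous component of `D_n · h` is `h(0) · D_n` (all other products have
larger degree), monotone homogenisation is built into the tree's structure theorem, so the balanced
decomposition — and with it Valiant's bound — applies to that component of any monotone circuit for
`D_n · h` (`exists_balanced_decomposition_component`, the tree's proof verbatim for a possibly
inhomogeneous output; `monotone_lower_bound_of_coeff_zero_ne_zero`).  So in the Hrubeš–Yehudayoff normal
form `D_n · h = g` any successful `h` lies in the ideal generated by the variables (as the pivot
products of star–mesh elimination and the sub-region products of condensation schemes do).
[cite: Valiant1980, §3 Thm 1]
-/

namespace Summit.ValiantsHypothesis.ValiantsHypothesis.Theorems.TriangularDimersDivisionEasy.Negative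

open Literature.Computability.AlgebraicComplexity
open MvPolynomial
open scoped BigOperators NNReal

set_option linter.dupNamespace false

noncomputable section

open Classical

/-! ## The structure theorem for the top fully ordered component of an inhomogeneous output -/

section Structure

open DepthReduction

universe u v

variable {ι : Type u} {κ : Type v} [Fintype ι] [DecidableEq ι]

/-- **Structure theorem, component form.**  If a straight-line program over `ℝ≥0` computes `g` whose
homogeneous component of degree `n = |ι|` is fully ordered, that component is a sum of at most
`4 s (n+1)²` nearly balanced ordered products dominated by it (the tree's
`SLP.exists_balanced_decomposition`, whose proof homogenises anyway, read for an inhomogeneous output).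
[cite: ChattopadhyayDattaGhosalMukhopadhyay2022, §2, Thm. 2.1] -/
theorem SLP.exists_balanced_decomposition_component (S : SLP ℝ≥0 (ι × κ)) {i : ℕ}
    (hi : i < S.len) (hord : IsFullyOrdered (homogeneousComponent (Fintype.card ι) (S.val i)))
    (hn : 3 ≤ Fintype.card ι) :
    ∃ L : List (Finset ι × MvPolynomial (ι × κ) ℝ≥0 × MvPolynomial (ι × κ) ℝ≥0),
      L.length ≤ 4 * S.len * (Fintype.card ι + 1) ^ 2 ∧
      (L.map fun t => t.2.1 * t.2.2).sum = homogeneousComponent (Fintype.card ι) (S.val i) ∧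
      ∀ t ∈ L, IsOrdered t.1 t.2.1 ∧ IsOrdered t.1ᶜ t.2.2 ∧
        Fintype.card ι < 3 * t.1.card ∧ 3 * t.1.card ≤ 2 * Fintype.card ι ∧
        ∀ m, coeff m (t.2.1 * t.2.2) ≤ coeff m (homogeneousComponent (Fintype.card ι) (S.val i)) := by
  classical
  set n := Fintype.card ι with hn_def
  set p := homogeneousComponent n (S.val i) with hp_def
  set H := S.homogenize n with hH
  let α : S.Node n := (⟨i, hi⟩, SLP.Tag.Q (Fin.last n))
  have hval : H.val α = p := by
    change S.hval n (⟨i, hi⟩, SLP.Tag.Q (Fin.last n)) = p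
    rw [SLP.hval_Q]
    rfl
  have hdegα : H.deg α = n := rfl
  set m := 2 * n / 3 with hm_def
  have hm1 : 1 ≤ m := by omega
  have hmn : m < H.deg α := by rw [hdegα]; omega
  have key := H.val_eq_sum_frontier hm1 hmn
  rw [hval] at key
  let hv : S.Node n → S.Node n := fun μ => H.heavy (H.children μ).1 (H.children μ).2
  let lt : S.Node n → S.Node n := fun μ => H.light (H.children μ).1 (H.children μ).2
  let a : S.Node n → MvPolynomial (ι × κ) ℝ≥0 := fun μ => H.val (hv μ)
  let b : S.Node n → MvPolynomial (ι × κ) ℝ≥0 := fun μ => H.quot α μ * H.val (lt μ)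
  have hterm : ∀ μ ∈ H.frontier m, H.quot α μ * H.val μ = a μ * b μ := by
    intro μ hμ
    obtain ⟨hk, -, -, -⟩ := H.of_mem_frontier hμ
    change H.quot α μ * H.val μ = H.val (hv μ) * (H.quot α μ * H.val (lt μ))
    rw [H.val_prod_eq hk]
    ring
  have key' : p = ∑ μ ∈ H.frontier m, a μ * b μ := key.trans (Finset.sum_congr rfl hterm)
  set T := (H.frontier m).filter fun μ => a μ * b μ ≠ 0 with hT
  have hsumT : ∑ μ ∈ T, a μ * b μ = p := by
    rw [hT, Finset.sum_filter_ne_zero, ← key']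
  have hle : ∀ μ ∈ T, ∀ mm, coeff mm (a μ * b μ) ≤ coeff mm p := by
    intro μ hμ mm
    rw [← hsumT]
    exact coeff_le_coeff_sum T (fun μ => a μ * b μ) hμ mm
  have hfo : ∀ μ ∈ T, IsFullyOrdered (a μ * b μ) := by
    intro μ hμ mm hmm
    apply hord mm
    rw [mem_support_iff] at hmm ⊢
    exact fun h0 => hmm (le_antisymm ((hle μ hμ mm).trans h0.le) zero_le)
  have hex : ∀ μ ∈ T, ∃ A : Finset ι, IsOrdered A (a μ) ∧ IsOrdered Aᶜ (b μ) := by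
    intro μ hμ
    exact exists_isOrdered_of_mul (hfo μ hμ) (Finset.mem_filter.1 hμ).2
  choose! A hA using hex
  have hcard : ∀ μ ∈ T, n < 3 * (A μ).card ∧ 3 * (A μ).card ≤ 2 * n := by
    intro μ hμ
    have hμF : μ ∈ H.frontier m := (Finset.mem_filter.1 hμ).1
    have hne : a μ * b μ ≠ 0 := (Finset.mem_filter.1 hμ).2
    have ha0 : a μ ≠ 0 := fun h0 => hne (by rw [h0, zero_mul])
    obtain ⟨hk, hdμ, h1, h2⟩ := H.of_mem_frontier hμF
    have hc : (A μ).card = H.deg (hv μ) :=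
      card_eq_of_isOrdered (hA μ hμ).1 (S.isHomogeneous_homogenize_val n (hv μ)) ha0
    have hdeg := H.deg_prod_eq hk
    have hll := H.deg_light_le (H.children μ).1 (H.children μ).2
    have hhm := H.deg_heavy_le_of h1 h2
    change H.deg μ = H.deg (lt μ) + H.deg (hv μ) at hdeg
    change H.deg (lt μ) ≤ H.deg (hv μ) at hll
    change H.deg (hv μ) ≤ m at hhm
    rw [hc]
    omega
  refine ⟨T.toList.map fun μ => (A μ, a μ, b μ), ?_, ?_, ?_⟩
  · rw [List.length_map, Finset.length_toList]
    exact (Finset.card_le_univ T).trans (S.card_node_le n)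
  · rw [List.map_map, ← hsumT, ← Finset.sum_map_toList]
    rfl
  · intro t ht
    obtain ⟨μ, hμ, rfl⟩ := List.mem_map.1 ht
    rw [Finset.mem_toList] at hμ
    exact ⟨(hA μ hμ).1, (hA μ hμ).2, (hcard μ hμ).1, (hcard μ hμ).2, hle μ hμ⟩

/-- **Structure theorem for monotone circuits, component form** (fan-in-two `ArithCircuit` over
`ℝ≥0`): the fully ordered top component of the computed polynomial is a sum of at most `4 s (n+1)²`
nearly balanced ordered products dominated by it. [cite: ChattopadhyayDattaGhosalMukhopadhyay2022, §2, Thm. 2.1] -/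
theorem ArithCircuit.exists_balanced_decomposition_component (P : ArithCircuit ℝ≥0 (ι × κ))
    (hP : P.IsFanInTwo) {g : MvPolynomial (ι × κ) ℝ≥0} (hc : P.Computes g)
    (hord : IsFullyOrdered (homogeneousComponent (Fintype.card ι) g)) (hn : 3 ≤ Fintype.card ι) :
    ∃ L : List (Finset ι × MvPolynomial (ι × κ) ℝ≥0 × MvPolynomial (ι × κ) ℝ≥0),
      L.length ≤ 4 * P.size * (Fintype.card ι + 1) ^ 2 ∧
      (L.map fun t => t.2.1 * t.2.2).sum = homogeneousComponent (Fintype.card ι) g ∧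
      ∀ t ∈ L, IsOrdered t.1 t.2.1 ∧ IsOrdered t.1ᶜ t.2.2 ∧
        Fintype.card ι < 3 * t.1.card ∧ 3 * t.1.card ≤ 2 * Fintype.card ι ∧
        ∀ m, coeff m (t.2.1 * t.2.2) ≤ coeff m (homogeneousComponent (Fintype.card ι) g) := by
  obtain ⟨S, hlen, h⟩ := DepthReduction.exists_slp P hP
  unfold ArithCircuit.Computes at hc
  rcases h with ⟨i, hi, hval⟩ | ⟨j, hj⟩ | ⟨c, hcC⟩
  · rw [← hc, hval, ← hlen]
    rw [← hc, hval] at hord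
    exact SLP.exists_balanced_decomposition_component S hi hord hn
  · refine ⟨[], by simp, ?_, by simp⟩
    rw [← hc, hj, List.map_nil, List.sum_nil]
    exact (homogeneousComponent_eq_zero _ _ (by rw [totalDegree_X]; omega)).symm
  · refine ⟨[], by simp, ?_, by simp⟩
    rw [← hc, hcC, List.map_nil, List.sum_nil]
    exact (homogeneousComponent_eq_zero _ _ (by rw [totalDegree_C]; omega)).symm

end Structure


/-! ## The top component of `D_n · h` -/

variable {n : ℕ}

/-- The degree-`n²` component of `D_n · h` is `h(0) · D_n`. [folklore] -/
theorem homogeneousComponent_triPM_mul (h : MvPolynomial (Var n) ℝ≥0) :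
    homogeneousComponent (Fintype.card (Vtx n)) (triPM n * h) = coeff 0 h • triPM n := by
  classical
  set N := Fintype.card (Vtx n) with hN
  have hhom : (triPM n).IsHomogeneous N := (isFullyOrdered_triPM n).isHomogeneous
  rw [DepthReduction.homogeneousComponent_mul, Finset.sum_eq_single N]
  · rw [homogeneousComponent_eq_self hhom, Nat.sub_self, homogeneousComponent_zero, smul_eq_C_mul, mul_comm]
  · intro i _ hne
    rw [homogeneousComponent_of_mem hhom, if_neg hne, zero_mul]
  · intro h; exact absurd (Finset.mem_range.2 (Nat.lt_succ_self N)) h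

/-- Hence it is fully ordered when `h(0) ≠ 0`. [folklore] -/
theorem isFullyOrdered_component_triPM_mul {h : MvPolynomial (Var n) ℝ≥0} (ha : coeff 0 h ≠ 0) :
    IsFullyOrdered (homogeneousComponent (Fintype.card (Vtx n)) (triPM n * h)) := by
  rw [homogeneousComponent_triPM_mul]
  intro m hm
  rw [support_smul_eq ha] at hm
  exact isFullyOrdered_triPM n m hm

/-! ## The lower bound for `D_n · h`, `h(0) ≠ 0` -/

/-- **Valiant's bound survives any denominator with non-zero constant term.**  For even `n ≥ 64`,
`24 L + 60 ≤ n` and `coeff 0 h ≠ 0`: `T^L ≤ 4 · L₊(D_n · h) · (n²+1)² · (T-1)^L`.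
[cite: Valiant1980, §3 Thm 1] -/
theorem monotone_lower_bound_of_coeff_zero_ne_zero (h64 : 64 ≤ n) (he : Even n) {L : ℕ}
    (hL : 24 * L + 60 ≤ n) {h : MvPolynomial (Var n) ℝ≥0} (ha : coeff 0 h ≠ 0) :
    Tfib ^ L ≤ 4 * complexity (triPM n * h) * (n * n + 1) ^ 2 * (Tfib - 1) ^ L := by
  have hn : 0 < n := by omega
  set a := coeff 0 h with ha_def
  obtain ⟨P, hP2, hPc, hPs⟩ := ArithCircuit.exists_computes_size_eq_complexity (triPM n * h)
  have hcard : Fintype.card (Vtx n) = n * n := by simp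
  have h3 : 3 ≤ Fintype.card (Vtx n) := by rw [hcard]; nlinarith
  obtain ⟨Ls, hlen, hsum, hterms⟩ :=
    ArithCircuit.exists_balanced_decomposition_component P hP2 hPc (isFullyOrdered_component_triPM_mul ha) h3
  rw [homogeneousComponent_triPM_mul] at hsum hterms
  rw [hcard, hPs] at hlen
  -- each rectangle, rescaled by `a⁻¹`, is dominated by `D_n`
  have hrect : ∀ t ∈ Ls, Tfib ^ L * (t.2.1 * t.2.2).support.card ≤ (Tfib - 1) ^ L * (dimers n).card := by
    intro t ht
    obtain ⟨hoa, hob, hb1, hb2, hdom⟩ := hterms t ht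
    rw [hcard] at hb1 hb2
    obtain ⟨G, hGlen, hGV, hGfar, hGmix⟩ := exists_gadgets hn t.1 (by omega) hb1 hb2
    have hLle : L ≤ G.length := by omega
    set G' := G.take L with hG'
    have hG'len : G'.length = L := by rw [hG', List.length_take]; exact min_eq_left hLle
    have hsub : G'.Sublist G := List.take_sublist _ _
    -- rescale the first factor
    have hoa' : IsOrdered t.1 (a⁻¹ • t.2.1) := by
      intro m hm
      rw [support_smul_eq (inv_ne_zero ha)] at hm
      exact hoa m hm
    have hdom' : ∀ m, coeff m (a⁻¹ • t.2.1 * t.2.2) ≤ coeff m (triPM n) := by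
      intro m
      rw [smul_mul_assoc, coeff_smul]
      have := hdom m
      rw [coeff_smul] at this
      calc a⁻¹ • coeff m (t.2.1 * t.2.2) ≤ a⁻¹ • (a • coeff m (triPM n)) := by
            exact smul_le_smul_of_nonneg_left this (by positivity)
        _ = coeff m (triPM n) := by rw [smul_smul, inv_mul_cancel₀ ha, one_smul]
    have hsupp : (a⁻¹ • t.2.1 * t.2.2).support = (t.2.1 * t.2.2).support := by
      rw [smul_mul_assoc, support_smul_eq (inv_ne_zero ha)]
    have := rect_card_le hn t.1 hoa' hob hdom' G' (fun g hg => hGV g (hsub.subset hg)) (hGfar.sublist hsub)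
      (fun g hg => hGmix g (hsub.subset hg))
    rw [hG'len, hsupp] at this
    exact this
  -- supports add up to at least the number of covers
  have hcov : (dimers n).card ≤ (Ls.map fun t => (t.2.1 * t.2.2).support.card).sum := by
    rw [← card_support_triPM, ← support_smul_eq ha (triPM n), ← hsum]
    have := card_support_list_sum_le (Ls.map fun t => t.2.1 * t.2.2)
    rw [List.map_map] at this
    exact this
  have hpos : 0 < (dimers n).card := Finset.card_pos.2 (dimers_nonempty he)
  have key : Tfib ^ L * (dimers n).card ≤ Ls.length * ((Tfib - 1) ^ L * (dimers n).card) := by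
    calc Tfib ^ L * (dimers n).card ≤ Tfib ^ L * (Ls.map fun t => (t.2.1 * t.2.2).support.card).sum :=
          Nat.mul_le_mul_left _ hcov
      _ = (Ls.map fun t => Tfib ^ L * (t.2.1 * t.2.2).support.card).sum := by
          rw [List.sum_map_mul_left]
      _ ≤ (Ls.map fun t => Tfib ^ L * (t.2.1 * t.2.2).support.card).length * ((Tfib - 1) ^ L * (dimers n).card) := by
          apply list_sum_le_length_mul
          intro x hx
          rw [List.mem_map] at hx
          obtain ⟨t, ht, rfl⟩ := hx
          exact hrect t ht
      _ = Ls.length * ((Tfib - 1) ^ L * (dimers n).card) := by rw [List.length_map]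
  have key2 : Tfib ^ L ≤ Ls.length * (Tfib - 1) ^ L := by
    have : Tfib ^ L * (dimers n).card ≤ (Ls.length * (Tfib - 1) ^ L) * (dimers n).card := by
      rw [mul_assoc]; exact key
    exact Nat.le_of_mul_le_mul_right this hpos
  calc Tfib ^ L ≤ Ls.length * (Tfib - 1) ^ L := key2
    _ ≤ (4 * complexity (triPM n * h) * (n * n + 1) ^ 2) * (Tfib - 1) ^ L := Nat.mul_le_mul_right _ hlen

/-! ## The asymptotic corollary -/

/-- From a lower bound of Valiant's shape for a quantity `F` at `n = 2^m`, `m ≥ 6`, a quasi-polynomial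
upper bound `F ≤ 2^((m+c)^c)` forces `2^m ≤ 24·T·((m+c)^c + 4m + 6) + 60`. [folklore] -/
theorem key_ineq_of_bound {c m F : ℕ} (hm : 6 ≤ m)
    (hlb : ∀ L, 24 * L + 60 ≤ 2 ^ m → Tfib ^ L ≤ 4 * F * (2 ^ m * 2 ^ m + 1) ^ 2 * (Tfib - 1) ^ L)
    (hF : F ≤ 2 ^ ((m + c) ^ c)) :
    2 ^ m ≤ 24 * Tfib * ((m + c) ^ c + 4 * m + 6) + 60 := by
  set M := Tfib - 1 with hM
  have hT : Tfib = M + 1 := Tfib_eq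
  set n := 2 ^ m with hn
  set k := (n - 60) / (24 * Tfib) with hk
  have hTpos : 0 < 24 * Tfib := by rw [hT]; omega
  have hL : 24 * (Tfib * k) + 60 ≤ n := by
    have h1 : k * (24 * Tfib) ≤ n - 60 := Nat.div_mul_le_self _ _
    have h2 : 24 * (Tfib * k) = k * (24 * Tfib) := by ring
    have h64 : 64 ≤ n := by
      calc 64 = 2 ^ 6 := by norm_num
        _ ≤ 2 ^ m := Nat.pow_le_pow_right (by norm_num) hm
    omega
  have hmain := hlb (Tfib * k) hL
  have hpow := two_pow_mul_pow_le M k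
  rw [← hT] at hpow
  have h2k : 2 ^ k ≤ 4 * F * (n * n + 1) ^ 2 := by
    have hposT : 0 < M ^ (Tfib * k) := Nat.pow_pos (by rw [hM]; unfold Tfib; norm_num)
    have : 2 ^ k * M ^ (Tfib * k) ≤ (4 * F * (n * n + 1) ^ 2) * M ^ (Tfib * k) := hpow.trans hmain
    exact Nat.le_of_mul_le_mul_right this hposT
  have hn2 : n * n + 1 ≤ 2 ^ (2 * m + 1) := by
    have : n * n = 2 ^ (2 * m) := by rw [hn, ← pow_add]; ring_nf
    rw [this, pow_succ]
    have : 1 ≤ 2 ^ (2 * m) := Nat.one_le_two_pow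
    omega
  have hrhs : 4 * F * (n * n + 1) ^ 2 ≤ 2 ^ ((m + c) ^ c + 4 * m + 4) := by
    calc 4 * F * (n * n + 1) ^ 2 ≤ 4 * 2 ^ ((m + c) ^ c) * (2 ^ (2 * m + 1)) ^ 2 :=
          Nat.mul_le_mul (Nat.mul_le_mul_left _ hF) (Nat.pow_le_pow_left hn2 2)
      _ = 2 ^ ((m + c) ^ c + 4 * m + 4) := by
          rw [← pow_mul, show (4 : ℕ) = 2 ^ 2 from rfl, ← pow_add, ← pow_add]; ring_nf
  have hkle : k ≤ (m + c) ^ c + 4 * m + 4 :=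
    (Nat.pow_le_pow_iff_right (by norm_num)).1 (h2k.trans hrhs)
  have hdiv : n - 60 < k * (24 * Tfib) + 24 * Tfib := by
    have := Nat.lt_div_mul_add (a := n - 60) hTpos
    rw [← hk] at this; exact this
  have h7 : n ≤ 24 * Tfib * (k + 1) + 60 := by
    have : 24 * Tfib * (k + 1) = k * (24 * Tfib) + 24 * Tfib := by ring
    omega
  calc 2 ^ m = n := rfl
    _ ≤ 24 * Tfib * (k + 1) + 60 := h7
    _ ≤ 24 * Tfib * ((m + c) ^ c + 4 * m + 6) + 60 := by
        apply Nat.add_le_add_right; apply Nat.mul_le_mul_left; omega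

/-- `2^m ≤ 24·T·((m+c)^c + 4m + 6) + 60` fails for `m = 2^t`, `t` large. [folklore] -/
theorem exists_m_violating (c : ℕ) : ∃ m, 6 ≤ m ∧ 24 * Tfib * ((m + c) ^ c + 4 * m + 6) + 60 < 2 ^ m := by
  obtain ⟨t, ht7, ht⟩ := exists_lt_two_pow (c + 1) (c * c + 124)
  refine ⟨2 ^ t, ?_, ?_⟩
  · calc 6 ≤ 2 ^ 7 := by norm_num
      _ ≤ 2 ^ t := Nat.pow_le_pow_right (by norm_num) ht7
  set m := 2 ^ t with hm
  have h1 : (m + c) ^ c ≤ 2 ^ (t * c + c * c) := by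
    have hc1 : m + c ≤ 2 ^ t * 2 ^ c := by
      have h1 : c < 2 ^ c := Nat.lt_two_pow_self
      have h2 : 1 ≤ 2 ^ c := Nat.one_le_two_pow
      have h3 : 1 ≤ 2 ^ t := Nat.one_le_two_pow
      rw [hm]; nlinarith
    calc (m + c) ^ c ≤ (2 ^ t * 2 ^ c) ^ c := Nat.pow_le_pow_left hc1 c
      _ = 2 ^ (t * c + c * c) := by rw [← pow_add, ← pow_mul]; ring_nf
  have h2 : 4 * m + 6 ≤ 2 ^ (t + 3) := by
    rw [hm, pow_add]
    have : 1 ≤ 2 ^ t := Nat.one_le_two_pow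
    norm_num; omega
  have h3 : (m + c) ^ c + 4 * m + 6 ≤ 2 ^ (t * c + c * c + t + 4) := by
    calc (m + c) ^ c + 4 * m + 6 ≤ 2 ^ (t * c + c * c) + 2 ^ (t + 3) := by omega
      _ ≤ 2 ^ (t * c + c * c + t + 3) + 2 ^ (t * c + c * c + t + 3) :=
          Nat.add_le_add (Nat.pow_le_pow_right (by norm_num) (by omega))
            (Nat.pow_le_pow_right (by norm_num) (by omega))
      _ = 2 ^ (t * c + c * c + t + 4) := by rw [← two_mul, ← pow_succ']
  have hT : 24 * Tfib ≤ 2 ^ 119 := by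
    calc 24 * Tfib ≤ 2 ^ 5 * 2 ^ 114 := Nat.mul_le_mul (by norm_num) Tfib_lt.le
      _ = 2 ^ 119 := by rw [← pow_add]
  have hpos : 1 ≤ 2 ^ (t * c + c * c + t + 4) := Nat.one_le_two_pow
  have h4 : 24 * Tfib * ((m + c) ^ c + 4 * m + 6) + 60 ≤ 2 ^ (t * c + c * c + t + 124) := by
    calc 24 * Tfib * ((m + c) ^ c + 4 * m + 6) + 60
        ≤ 2 ^ 119 * 2 ^ (t * c + c * c + t + 4) + 2 ^ 119 * 2 ^ (t * c + c * c + t + 4) := by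
          apply Nat.add_le_add (Nat.mul_le_mul hT h3)
          calc 60 ≤ 2 ^ 119 := by norm_num
            _ = 2 ^ 119 * 1 := (mul_one _).symm
            _ ≤ 2 ^ 119 * 2 ^ (t * c + c * c + t + 4) := Nat.mul_le_mul_left _ hpos
      _ = 2 ^ (t * c + c * c + t + 124) := by rw [← two_mul, ← pow_add, ← pow_succ']; ring_nf
  have h5 : t * c + c * c + t + 124 < 2 ^ t := by nlinarith
  calc 24 * Tfib * ((m + c) ^ c + 4 * m + 6) + 60 ≤ 2 ^ (t * c + c * c + t + 124) := h4
    _ < 2 ^ m := by rw [hm]; exact Nat.pow_lt_pow_right (by norm_num) h5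

/-- **The crux is false for every family of denominators with non-zero constant term.**  In the
normal form `D_n · h = g` of a subtraction-free circuit with division for `D_n`, a successful `h` must
vanish at the origin. [cite: Valiant1980, §3 Thm 1] -/
theorem not_divisionEasy_with_unit_h :
    ¬ ∃ c : ℕ, ∀ n : ℕ, ∃ h : MvPolynomial (Var n) ℝ≥0,
      coeff 0 h ≠ 0 ∧ complexity (triPM n * h) + complexity h ≤ bound c n := by
  rintro ⟨c, H⟩
  obtain ⟨m, hm6, hviol⟩ := exists_m_violating c
  obtain ⟨h, ha, hle⟩ := H (2 ^ m)
  have he : Even (2 ^ m) := (Nat.even_pow.2 ⟨even_two, by omega⟩)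
  have h64 : 64 ≤ 2 ^ m := by
    calc 64 = 2 ^ 6 := by norm_num
      _ ≤ 2 ^ m := Nat.pow_le_pow_right (by norm_num) hm6
  have hlog : Nat.log 2 (2 ^ m) = m := Nat.log_pow (by norm_num) _
  have hF : complexity (triPM (2 ^ m) * h) ≤ 2 ^ ((m + c) ^ c) := by
    have := le_of_add_le_left hle
    unfold bound at this; rw [hlog] at this; exact this
  have hkey := key_ineq_of_bound hm6 (fun L hL => monotone_lower_bound_of_coeff_zero_ne_zero h64 he hL ha) hF
  exact absurd (hkey.trans_lt hviol) (lt_irrefl _)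

end

end Summit.ValiantsHypothesis.ValiantsHypothesis.Theorems.TriangularDimersDivisionEasy.Negative
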